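import Summits.QuantumFields.YangMills.Theses.TypicalExteriorCeilings
import Summits.QuantumFields.YangMills.Theorems.TypicalExteriorCeilingsSplitGlue
import HarnessLib

/-!
# Birth skeleton (BC3) for the deciding crux `AnnealedBoundaryLaw` (stmt-QuantumFields-25891) of route `TypicalExteriorCeilings`
# — the line of record = the route's generation-1 GLUED SPLIT V / M

Tribunal-w seat `ym-tec-bc5w-1` (g2), answering the tribunal's round-1 T3 order «publish V/M split as
Cruxes/AnnealedBoundaryLaw/Lines/birth.lean».  HONEST FRAMING: the Yang–Mills mass gap is NOT proved; the route's leaf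
`InfiniteVolumeContinuum.HypercubicOSDataFromInfiniteVolume` (stmt-19868), `BalabanLadder.NT`, and K1 / V / M are NOT proved and not
claimed here; no prover is seated on TEC by this file.

    AnnealedBoundaryLaw (K1, stmt-25891: annealed L^p femto boundary law, E_T|Ȳ|^p ≤ (C p^κ/R⁴)^p at sub-onset resolutions)
      ⇐ stub_varianceBoundaryLaw   = route item V `VarianceBoundaryLaw`  (stmt-25920, crux r201): the p = 2 layer,
                                     E_T|Ȳ|² ≤ (C_V/R⁴)² — L²-mixing / hyperscaling ceiling of the conditional plane mean;
      ⇐ stub_momentComparability   = route item M `MomentComparability` (stmt-25921, crux r202): scale-free reverse Hölder,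
                                     (E_T|Ȳ|^p)² ≤ (C_M p^κ)^{2p} (E_T|Ȳ|²)^p;
    composition `AnnealedBoundaryLaw_of` = the LANDED glue `Theorems.TypicalExteriorCeilings.annealedBoundaryLawGlue_proof`
    (item stmt-25922 CLOSED proved, p612320): ε₀ := min, ℓ₁ := min, β₁ := max, C := C_M·C_V, κ := κ_M.

The two stubs are stated BY NAME as the route's own item decls (they ARE the registered children of the split; a prover closes a stub by
closing the item).  BC5 rung α for both stubs is LANDED (free-field instances with κ = 1, `Lines/rung.lean`,
`Cruxes.AnnealedBoundaryLaw.GaussianRung.rung_varianceBoundaryLaw_freeField` / `rung_momentComparability_freeField`, p613337), and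
the witness model is non-vacuous (landed `Cruxes.AnnealedBoundaryLaw.GaussianRung.exists_isDiscreteGFF_four`).
Hardest stub: `stub_varianceBoundaryLaw` (the n = 2 sub-onset hyperscaling wall of the IV-ceilings family; see `Lines/birth.md`).
-/

set_option autoImplicit false

namespace Summit.QuantumFields.YangMills.Cruxes.AnnealedBoundaryLaw.Birth

open Summit.QuantumFields.YangMills.Theses.TypicalExteriorCeilings

/-- STUB V (= route item stmt-QuantumFields-25920 `VarianceBoundaryLaw`, crux, open): the torus-state variance of the DLR-kernel mean of one
plane field at the centre of a femto cube of side `2R+3`, at sub-onset resolutions, is `≤ (C/R⁴)²`. -/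
theorem stub_varianceBoundaryLaw : VarianceBoundaryLaw := by
  sorry

/-- STUB M (= route item stmt-QuantumFields-25921 `MomentComparability`, crux, open): `(E_T|Ȳ|^p)² ≤ (C p^κ)^{2p} (E_T|Ȳ|²)^p` for the same
conditional plane mean, every `p ≥ 1`, no rate in `R`. -/
theorem stub_momentComparability : MomentComparability := by
  sorry

/-- COMPOSITION (kernel-checked, no sorry): V → M → K1 is the landed split glue (stmt-25922). -/
theorem AnnealedBoundaryLaw_of :
    VarianceBoundaryLaw → MomentComparability →
      Summit.QuantumFields.YangMills.Theses.TypicalExteriorCeilings.AnnealedBoundaryLaw :=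
  Summit.QuantumFields.YangMills.Theorems.TypicalExteriorCeilings.annealedBoundaryLawGlue_proof

/-- The crux from the two stubs (sorries only inside `stub_*`). -/
theorem annealedBoundaryLaw_from_stubs :
    Summit.QuantumFields.YangMills.Theses.TypicalExteriorCeilings.AnnealedBoundaryLaw :=
  AnnealedBoundaryLaw_of stub_varianceBoundaryLaw stub_momentComparability

end Summit.QuantumFields.YangMills.Cruxes.AnnealedBoundaryLaw.Birth
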